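import Summits.QuantumAdvantage.QuantumAdvantage.Theorems.CubicForrelationNearExactIsExactCubicFormCellL2
import Summits.QuantumAdvantage.QuantumAdvantage.Theorems.CubicForrelationNearExactIsExactCubicFormHalvesRankTwo
import Summits.QuantumAdvantage.QuantumAdvantage.Theorems.CubicForrelationNearExactIsExactCubicFormOmega4R
import Summits.QuantumAdvantage.QuantumAdvantage.Theorems.CubicForrelationNearExactIsExactCubicFormBalanced

/-!
# Crux `CubicForrelation.NearExactIsExact` (stmt-QuantumAdvantage-14043) — CELL LEMMA L2 for `μ = 2` (`t̄ = s₀ ∧ ω₄`), assembled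

Certificate seat `b2b-cforr-cert` (gen 41).  HONEST FRAMING: kernel-checked assembly (standard axioms) of …CubicFormCellL2 (halves of a
cell, the standard frame of `ω`), …CubicFormHalvesRankTwo (`tcl_halves_eight_mu2`, `_weak`) and …CubicFormOmega4R (`tw4_R_support`) into
the `μ = 2` row of cell lemma L2 (HOME/b2b-cforr-cert-g37/R2-PARTNER.md §3; HOME/b2b-cforr-cert-g39/E1280-HANDPROOFS.md §1.5–1.6):
for a cell `f` on `1 + 8` bits with cubic form `s₀ ∧ ω₄` (`ω₄` on the coordinates `lo 0, hi 0, lo 1, hi 1` of `H = 𝔽₂⁸`), halves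
`f₀, f₁` with forms `B₀, B₁` (`B₀ ⊕ B₁ = ω₄`):
  `wt f < 160 ⇒ B₀ = 0 ∨ B₁ = 0 ∨ (B₀, B₁ both of rank 2 — family R — AND both supported on P × P)`;
  `wt f < 192 ⇒ B₀ = 0 ∨ B₁ = 0 ∨ rank B₀ ≤ 2 ∨ rank B₁ ≤ 2` (family `B₂`).
Nothing about `θ₁₂`; NOT summit progress.

* `tl2m_omega_unit`: `ω₄(x, e_{lo i}) = x_{hi i}`, `ω₄(x, e_{hi i}) = x_{lo i}`.
* `tl2_cell_eight_mu2`: the statement above.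

References: R2-PARTNER.md §3 (L2, μ = 2); E1280-HANDPROOFS.md §1.5–1.6.  Axioms: the standard three.
-/

set_option linter.dupNamespace false -- D-0017: single-problem summit ⇒ `QuantumAdvantage.QuantumAdvantage` by design

namespace Summit.QuantumAdvantage.QuantumAdvantage.Theorems.CubicForrelation.NearExactIsExact

open Finset
open Literature.Computability.QuantumComplexity.BuzetChailloux (bxor zeroVec allOnes bxor_comm bxor_self bxor_zeroVec zeroVec_bxor
  bxor_bxor_cancel_left)

/-- **`ω₄` against unit vectors.**  For the form `ω'` of `tl2_cell_eight` with `h = 2`: `ω'(x, e_{lo i}) = x (hi i)` and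
`ω'(x, e_{hi i}) = x (lo i)`. [bookkeeping] -/
theorem tl2m_omega_unit (lo hi : Fin 2 → Fin 8) (hlo : Function.Injective lo) (hhi : Function.Injective hi) (hlohi : ∀ i j, lo i ≠ hi j)
    (ω' : (Fin 8 → Bool) → (Fin 8 → Bool) → Bool)
    (hω' : ∀ v w, ω' v w = decide ((∑ i : Fin 2, ((if v (lo i) = true then (1 : ZMod 2) else 0) * (if w (hi i) = true then (1 : ZMod 2) else 0) +
        (if v (hi i) = true then (1 : ZMod 2) else 0) * (if w (lo i) = true then (1 : ZMod 2) else 0))) = 1))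
    (x : Fin 8 → Bool) (i : Fin 2) :
    ω' x (fun l => decide (l = lo i)) = x (hi i) ∧ ω' x (fun l => decide (l = hi i)) = x (lo i) := by
  have h01 : (lo 0 = lo 1) = False := propext ⟨fun e => absurd (hlo e) (by decide), False.elim⟩
  have h10 : (lo 1 = lo 0) = False := propext ⟨fun e => absurd (hlo e) (by decide), False.elim⟩
  have k01 : (hi 0 = hi 1) = False := propext ⟨fun e => absurd (hhi e) (by decide), False.elim⟩
  have k10 : (hi 1 = hi 0) = False := propext ⟨fun e => absurd (hhi e) (by decide), False.elim⟩
  have hl : ∀ a b, (hi a = lo b) = False := fun a b => propext ⟨fun e => hlohi b a e.symm, False.elim⟩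
  have hl' : ∀ a b, (lo a = hi b) = False := fun a b => propext ⟨fun e => hlohi a b e, False.elim⟩
  rcases Fin.exists_fin_two.mp ⟨i, rfl⟩ with h | h <;> subst h <;> refine ⟨?_, ?_⟩ <;> rw [hω'] <;>
    simp only [Fin.sum_univ_two, Fin.isValue, decide_eq_true_eq, hl, hl', h01, h10, k01, k10, if_false, if_true,
      mul_zero, mul_one, add_zero, zero_add] <;>
    cases x (hi 0) <;> cases x (hi 1) <;> cases x (lo 0) <;> cases x (lo 1) <;> decide

/-- **Cell lemma L2, `μ = 2`.**  See the module docstring. [this work; R2-PARTNER §3 L2] -/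
theorem tl2_cell_eight_mu2 (f : (Fin (1 + 8) → Bool) → Bool) (lo hi : Fin 2 → Fin 8)
    (hlo : Function.Injective lo) (hhi : Function.Injective hi) (hlohi : ∀ i j, lo i ≠ hi j)
    (ω' : (Fin 8 → Bool) → (Fin 8 → Bool) → Bool)
    (hω' : ∀ v w, ω' v w = decide ((∑ i : Fin 2, ((if v (lo i) = true then (1 : ZMod 2) else 0) * (if w (hi i) = true then (1 : ZMod 2) else 0) +
        (if v (hi i) = true then (1 : ZMod 2) else 0) * (if w (lo i) = true then (1 : ZMod 2) else 0))) = 1))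
    (hT : ∀ u v w x : Fin (1 + 8) → Bool,
      (((f x ^^ f (bxor x w)) ^^ (f (bxor x v) ^^ f (bxor (bxor x v) w))) ^^
          ((f (bxor x u) ^^ f (bxor (bxor x u) w)) ^^ (f (bxor (bxor x u) v) ^^ f (bxor (bxor (bxor x u) v) w)))) =
        (((u (Fin.castAdd 8 (0 : Fin 1)) && ω' (fun j => v (Fin.natAdd 1 j)) (fun j => w (Fin.natAdd 1 j))) ^^
            (v (Fin.castAdd 8 (0 : Fin 1)) && ω' (fun j => u (Fin.natAdd 1 j)) (fun j => w (Fin.natAdd 1 j)))) ^^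
          (w (Fin.castAdd 8 (0 : Fin 1)) && ω' (fun j => u (Fin.natAdd 1 j)) (fun j => v (Fin.natAdd 1 j))))) :
    let f₀ : (Fin 8 → Bool) → Bool := fun s => f (Fin.append ![false] s)
    let f₁ : (Fin 8 → Bool) → Bool := fun s => f (Fin.append ![true] s)
    let B₀ : (Fin 8 → Bool) → (Fin 8 → Bool) → Bool := fun v w =>
      (f₀ zeroVec ^^ f₀ (bxor zeroVec w)) ^^ (f₀ (bxor zeroVec v) ^^ f₀ (bxor (bxor zeroVec v) w))
    let B₁ : (Fin 8 → Bool) → (Fin 8 → Bool) → Bool := fun v w =>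
      (f₁ zeroVec ^^ f₁ (bxor zeroVec w)) ^^ (f₁ (bxor zeroVec v) ^^ f₁ (bxor (bxor zeroVec v) w))
    (∀ v w x, ((f₀ x ^^ f₀ (bxor x w)) ^^ (f₀ (bxor x v) ^^ f₀ (bxor (bxor x v) w))) = B₀ v w) ∧
    (∀ v w x, ((f₁ x ^^ f₁ (bxor x w)) ^^ (f₁ (bxor x v) ^^ f₁ (bxor (bxor x v) w))) = B₁ v w) ∧
    (∀ v w, (B₀ v w ^^ B₁ v w) = ω' v w) ∧
    (#(univ.filter fun y : Fin (1 + 8) → Bool => f y = true) < 160 →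
      (∀ x y, B₀ x y = false) ∨ (∀ x y, B₁ x y = false) ∨
      ((∃ p q : Fin 8 → Bool, ∀ x y, B₀ x y = ((B₀ x q && B₀ y p) ^^ (B₀ x p && B₀ y q))) ∧
       (∃ p q : Fin 8 → Bool, ∀ x y, B₁ x y = ((B₁ x q && B₁ y p) ^^ (B₁ x p && B₁ y q))) ∧
       (∀ x, (∀ i, x (lo i) = false) → (∀ i, x (hi i) = false) → ∀ y, B₀ x y = false ∧ B₁ x y = false))) ∧
    (#(univ.filter fun y : Fin (1 + 8) → Bool => f y = true) < 192 →
      (∀ x y, B₀ x y = false) ∨ (∀ x y, B₁ x y = false) ∨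
      (∃ p q : Fin 8 → Bool, ∀ x y, B₀ x y = ((B₀ x q && B₀ y p) ^^ (B₀ x p && B₀ y q))) ∨
      (∃ p q : Fin 8 → Bool, ∀ x y, B₁ x y = ((B₁ x q && B₁ y p) ^^ (B₁ x p && B₁ y q)))) := by
  intro f₀ f₁ B₀ B₁
  obtain ⟨h3, hforms⟩ := tl2_cell_halves f ω' hT
  have h30 := h3 false
  have h31 := h3 true
  simp only at h30 h31
  have hB₀' : ∀ v w x, ((f₀ x ^^ f₀ (bxor x w)) ^^ (f₀ (bxor x v) ^^ f₀ (bxor (bxor x v) w))) = B₀ v w :=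
    fun v w x => tl2_second_const f₀ h30 v w x
  have hB₁' : ∀ v w x, ((f₁ x ^^ f₁ (bxor x w)) ^^ (f₁ (bxor x v) ^^ f₁ (bxor (bxor x v) w))) = B₁ v w :=
    fun v w x => tl2_second_const f₁ h31 v w x
  have hω : ∀ v w, (B₀ v w ^^ B₁ v w) = ω' v w := fun v w => by
    rw [← hB₀' v w zeroVec, ← hB₁' v w zeroVec]; exact hforms v w zeroVec zeroVec
  obtain ⟨o1, o2, o3, -, omax⟩ := tl2_omega_frame 2 lo hi hlo hhi hlohi ω' hω'
  have hcard : #(univ.filter fun y : Fin (1 + 8) → Bool => f y = true) =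
      #(univ.filter fun x : Fin 8 → Bool => f₀ x = true) + #(univ.filter fun x : Fin 8 → Bool => f₁ x = true) := tco_card_halves f
  -- the frame of `ω'` as a frame of `B₀ ⊕ B₁`
  have g1 : ∀ i, (B₀ (fun l => decide (l = lo i)) (fun l => decide (l = hi i)) ^^ B₁ (fun l => decide (l = lo i)) (fun l => decide (l = hi i))) = true :=
    fun i => by rw [hω]; exact o1 i
  have g2 : ∀ i j, i ≠ j → (B₀ (fun l => decide (l = lo i)) (fun l => decide (l = hi j)) ^^
      B₁ (fun l => decide (l = lo i)) (fun l => decide (l = hi j))) = false := fun i j hij => by rw [hω]; exact o2 i j hij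
  have g3 : ∀ i j, (B₀ (fun l => decide (l = lo i)) (fun l => decide (l = lo j)) ^^
      B₁ (fun l => decide (l = lo i)) (fun l => decide (l = lo j))) = false := fun i j => by rw [hω]; exact o3 i j
  have gmax : ∀ x y, (∀ i, (B₀ x (fun l => decide (l = lo i)) ^^ B₁ x (fun l => decide (l = lo i))) = false) →
      (∀ i, (B₀ x (fun l => decide (l = hi i)) ^^ B₁ x (fun l => decide (l = hi i))) = false) →
      (∀ i, (B₀ y (fun l => decide (l = lo i)) ^^ B₁ y (fun l => decide (l = lo i))) = false) →
      (∀ i, (B₀ y (fun l => decide (l = hi i)) ^^ B₁ y (fun l => decide (l = hi i))) = false) → (B₀ x y ^^ B₁ x y) = false := by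
    intro x y h1 h2 h3' h4
    rw [hω]
    exact omax x y (fun i => by rw [← hω]; exact h1 i) (fun i => by rw [← hω]; exact h2 i) (fun i => by rw [← hω]; exact h3' i)
      (fun i => by rw [← hω]; exact h4 i)
  refine ⟨hB₀', hB₁', hω, fun hlt => ?_, fun hlt => ?_⟩
  · rcases tcl_halves_eight_mu2 f₀ f₁ B₀ B₁ hB₀' hB₁' (fun i => fun l => decide (l = lo i)) (fun i => fun l => decide (l = hi i))
        g1 g2 g3 gmax (by rw [← hcard]; exact hlt) with hz | hz | ⟨⟨p₀, q₀, hP₀⟩, ⟨p₁, q₁, hP₁⟩⟩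
    · exact Or.inl hz
    · exact Or.inr (Or.inl hz)
    · refine Or.inr (Or.inr ⟨⟨p₀, q₀, hP₀⟩, ⟨p₁, q₁, hP₁⟩, fun x hxl hxh y => ?_⟩)
      obtain ⟨hs₀, ha₀, -, -⟩ := tcb_form_basic f₀ B₀ hB₀'
      obtain ⟨hs₁, ha₁, -, -⟩ := tcb_form_basic f₁ B₁ hB₁'
      refine tw4_R_support B₀ B₁ ω' hs₀ ha₀ hs₁ ha₁ (fun x y => (hω x y).symm) p₀ q₀ hP₀ p₁ q₁ hP₁
        (fun i => fun l => decide (l = lo i)) (fun i => fun l => decide (l = hi i)) o1 o2 o3 omax x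
        (fun i => ?_) (fun i => ?_) y
      · rw [(tl2m_omega_unit lo hi hlo hhi hlohi ω' hω' x i).1]; exact hxh i
      · rw [(tl2m_omega_unit lo hi hlo hhi hlohi ω' hω' x i).2]; exact hxl i
  · exact tcl_halves_eight_mu2_weak f₀ f₁ B₀ B₁ hB₀' hB₁' (fun i => fun l => decide (l = lo i)) (fun i => fun l => decide (l = hi i))
      g1 g2 g3 gmax (by rw [← hcard]; exact hlt)

end Summit.QuantumAdvantage.QuantumAdvantage.Theorems.CubicForrelation.NearExactIsExact
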